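import Literature.Analysis.FluidPDE.DriftHeatGalileanRescale
import Literature.Analysis.FluidPDE.AxisymSwirlDriftHeatData
import Literature.Analysis.FluidPDE.AncientAxisymFarFieldFlattening
import Literature.Analysis.FluidPDE.KNSSLemma21OfHarnackGap
import Literature.Analysis.FluidPDE.ParabolicHarnackDriftGapProofs
import HarnessLib

/-!
# Ancient axisymmetric solutions with bounded swirl: the swirl flattens on parabolic cubes far
# from the axis (Lei–Ren–Zhang 2019, Lemma 5.1 (ii), for the KNSS representative)

Analysis/FluidPDE **proofs file** (theorems only: no definitions, no named facts, no `sorry`) on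
the discharge path of `Literature.Analysis.FluidPDE.leiRenZhang2019_sliding` (Lei–Ren–Zhang,
arXiv:1902.11229, Lemma 5.1 "Sliding Property", second half: "up to a further subsequence, `Γ`
uniformly converges to a constant on `Q_R(x_n, t_n)`"). For the regular representative
`U + β(t)e_z` of KNSS 2009 §4 (`KNSS2009_regularity_axisymmetric_swirl`) with `|Γ| ≤ C₁`:

* `farField_swirl_osc_of_axisymmetric_add_drift` — for all `R, ε > 0` there is `ρ` such that
  `|Γ(t, x) − Γ(t', y)| ≤ ε` for all `t, t' ∈ (t₀ − R², t₀)`, `x, y ∈ B(x₀, R)`, whenever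
  `t₀ ≤ 0` and `r(x₀) ≥ ρ` (`Γ = swirl (U t)`).

Proof (a documented deviation from print, which passes to a limit `Γ⁽∞⁾` solving a heat
equation with constant drift and invokes the Liouville theorem for the heat equation; the
compactness of `Γ⁽ⁿ⁾` asserted in print needs interior parabolic estimates): in the Galilean
frame `x = z(σ) + λy` moving with the local velocity `z' = U(σ, x₀) + β(σ)e_z` and after the
parabolic rescaling `σ = λ²τ + σ₀`, the swirl belongs to the tree's local drift–heat class with
drift `λ(U(σ, ·) − U(σ, x₀) + (2/r)e_r)` (`isDriftHeatSolutionOn_galilean_rescale`,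
`AxisymSwirlDriftHeatData`), of size `≤ 1` once `U` is `1/(2λ)`-flat on the relevant ball
(Lemma 5.1 (i) for the representative, `farField_velocity_osc_of_axisymmetric_add_drift`) and
`r ≥ 4λ` there; the PROVED interior Harnack inequality with bounded drift
(`Lieberman1996_harnack_drift_gap_holds`, constant `C_H` for drift bound `1` and radii `≤ 1`)
gives the oscillation decay `osc_{Q(4^{-j})} ≤ (1 − 1/C_H)ʲ · 2C₁`
(`IsHarnackConstForGap.osc_iterate`), and `λ = 4ʲ R_in` is chosen so that the image of
`Q_R(t₀, x₀)` in the frame lies in `Q((0, T), 4^{-j})`.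

## References

* Z. Lei, X. Ren, Q. S. Zhang, arXiv:1902.11229, Lemma 5.1 and its proof (arXiv p. 13).
  [LeiRenZhang2019]
* G. M. Lieberman, *Second Order Parabolic Differential Equations* (1996), Ch. VI Thms 6.27–6.28.
  [Lieberman1996]
* G. Koch, N. Nadirashvili, G. Seregin, V. Šverák, Acta Math. 203 (2009) = arXiv:0709.3599, §4,
  (5.10). [KochNadirashviliSereginSverak2009]
-/

noncomputable section

open MeasureTheory Set Function Filter TopologicalSpace InnerProductSpace Metric WithLp
open _root_.Topology
open scoped RealInnerProductSpace Laplacian ContDiff NNReal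

namespace Literature.Analysis.FluidPDE

section FarFieldSwirl

/-- `‖e_r‖ ≤ 1` (`= 1` off the axis, junk `0` on it). [folklore] -/
private theorem norm_eR_le_one_ffs (x : EuclideanSpace ℝ (Fin 3)) : ‖eR x‖ ≤ 1 := by
  have hh : ‖(toLp 2 ![x 0, x 1, 0] : EuclideanSpace ℝ (Fin 3))‖ = cylRadius x := by
    rw [EuclideanSpace.norm_eq, cylRadius]
    congr 1
    simp [Fin.sum_univ_three]
  rw [eR, norm_smul, norm_inv, Real.norm_eq_abs, abs_of_nonneg (cylRadius_nonneg x), hh]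
  by_cases h : cylRadius x = 0
  · rw [h]; simp
  · rw [inv_mul_cancel₀ h]

/-- Balls away from the axis: `w ∈ B(x₀, R_b)` has `r(w) ≥ r(x₀) − R_b`. [folklore] -/
private theorem cylRadius_sub_le_of_mem_ball_ffs {x₀ w : EuclideanSpace ℝ (Fin 3)} {Rb : ℝ}
    (hw : w ∈ ball x₀ Rb) : cylRadius x₀ - Rb ≤ cylRadius w := by
  have h := cylRadius_le_cylRadius_add_norm_sub w x₀
  have hd : ‖x₀ - w‖ < Rb := by rw [← dist_eq_norm, dist_comm]; exact mem_ball.1 hw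
  linarith

/-- **Lei–Ren–Zhang 2019, Lemma 5.1 "Sliding Property" (ii), for the regular representative.**
Let `U + β(t) e_z` be as in `farField_velocity_osc_of_axisymmetric_add_drift` (a bounded weak
ancient solution, `U` bounded and Lipschitz in `x`, `t`, axisymmetric weakly divergence-free
slices, `|Γ| ≤ C₁`, `β` bounded measurable) and in addition let `U` have smooth slices with the
time-Lipschitz bounds (4.8) for all orders, be jointly measurable, and let `Γ = swirl (U t)`
satisfy the swirl equation (5.10) integrated in time off the axis with drift `U + β e_z` (the
output of `KNSS2009_regularity_axisymmetric_swirl`). Then for all `R, ε > 0` there is `ρ` such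
that `|Γ(t, x) − Γ(t', y)| ≤ ε` for all `t, t' ∈ (t₀ − R², t₀)` and `x, y ∈ B(x₀, R)` whenever
`t₀ ≤ 0` and `r(x₀) ≥ ρ`. Proof: module docstring. [cite: LeiRenZhang2019, Lemma 5.1 and its proof (arXiv p. 13); Lieberman1996, Ch. VI Thm 6.28] -/
theorem farField_swirl_osc_of_axisymmetric_add_drift
    {U : ℝ → EuclideanSpace ℝ (Fin 3) → EuclideanSpace ℝ (Fin 3)} {β : ℝ → ℝ}
    {M K L C₁ C : ℝ}
    (hsol : IsBoundedWeakNSSolutionOn (Iio 0) isOpen_Iio 1 (fun t x => U t x + β t • eZ))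
    (hUM : ∀ t < 0, ∀ x, ‖U t x‖ ≤ M)
    (hUx : ∀ t < 0, ∀ x y, ‖U t x - U t y‖ ≤ K * ‖x - y‖)
    (hUt : ∀ s < 0, ∀ t < 0, ∀ x, ‖U t x - U s x‖ ≤ L * |t - s|)
    (haxi : ∀ t < 0, IsAxisymmetric (U t))
    (hsw : ∀ t < 0, ∀ x, |swirl (U t) x| ≤ C₁)
    (hdiv : ∀ t < 0, IsWeaklyDivFree (U t))
    (hβm : Measurable β) (hβC : ∀ t, |β t| ≤ C)
    (hsm : ∀ t < 0, ContDiff ℝ ∞ (U t))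
    (hlipU : ∀ k : ℕ, ∃ L' : ℝ, ∀ s < 0, ∀ t < 0, ∀ x,
      ‖iteratedFDeriv ℝ k (U t) x - iteratedFDeriv ℝ k (U s) x‖ ≤ L' * |t - s|)
    (hUjm : Measurable (uncurry U))
    (hswirlEq : ∀ x, cylRadius x ≠ 0 → ∀ s t : ℝ, s ≤ t → t < 0 →
      swirl (U t) x - swirl (U s) x =
        ∫ τ in s..t, ((Δ (swirl (U τ))) x - fderiv ℝ (swirl (U τ)) x (U τ x + β τ • eZ) -
          2 / cylRadius x * partialDeriv (eR x) (swirl (U τ)) x)) :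
    ∀ R : ℝ, 0 < R → ∀ ε : ℝ, 0 < ε → ∃ ρ : ℝ, ∀ t₀ : ℝ, t₀ ≤ 0 →
      ∀ x₀ : EuclideanSpace ℝ (Fin 3), ρ ≤ cylRadius x₀ →
        ∀ t ∈ Ioo (t₀ - R ^ 2) t₀, ∀ t' ∈ Ioo (t₀ - R ^ 2) t₀,
          ∀ x ∈ ball x₀ R, ∀ y ∈ ball x₀ R, |swirl (U t) x - swirl (U t') y| ≤ ε := by
  intro R hR ε hε
  have hM0 : 0 ≤ M := (norm_nonneg _).trans (hUM (-1) (by norm_num) 0)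
  have hC0 : 0 ≤ C := (abs_nonneg _).trans (hβC 0)
  have hC₁0 : 0 ≤ C₁ := (abs_nonneg _).trans (hsw (-1) (by norm_num) 0)
  -- the Harnack constant at unit scale for unit drift bound, and the decay ratio `θ`
  obtain ⟨CH, hCH1, hH⟩ := (Lieberman1996_harnack_drift_gap_holds
    (E := EuclideanSpace ℝ (Fin 3))).exists_const (1 : ℝ) (R₀ := 1) one_pos
  have hθ0 : 0 ≤ 1 - 1 / CH := by
    have : 1 / CH ≤ 1 := by rw [div_le_one (by linarith)]; exact hCH1
    linarith
  have hθ1 : 1 - 1 / CH < 1 := by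
    have : 0 < 1 / CH := by positivity
    linarith
  obtain ⟨j, hj⟩ := exists_pow_lt_of_lt_one (show 0 < ε / (2 * C₁ + 1) by positivity) hθ1
  have hθj : (1 - 1 / CH) ^ j * (C₁ - -C₁) ≤ ε := by
    have h1 : (1 - 1 / CH) ^ j * (2 * C₁ + 1) ≤ ε := by
      have := (lt_div_iff₀ (by positivity : (0:ℝ) < 2 * C₁ + 1)).1 hj
      linarith
    have h2 : (1 - 1 / CH) ^ j * (C₁ - -C₁) ≤ (1 - 1 / CH) ^ j * (2 * C₁ + 1) :=
      mul_le_mul_of_nonneg_left (by linarith) (pow_nonneg hθ0 j)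
    linarith
  -- constants
  set V₀ : ℝ := M + C * ‖(eZ : EuclideanSpace ℝ (Fin 3))‖ + 1 with hV₀
  have hV₀pos : 0 < V₀ := by positivity
  set Rin : ℝ := R + V₀ * R ^ 2 + 1 with hRin
  have hRinR : R < Rin := by have : 0 < V₀ * R ^ 2 := by positivity
                             rw [hRin]; linarith
  have hRinpos : 0 < Rin := hR.trans hRinR
  have h4j : (0 : ℝ) < 4 ^ j := by positivity
  set lam : ℝ := 4 ^ j * Rin with hlamdef
  have hlam : 0 < lam := by positivity
  set T : ℝ := 2 with hT
  set Rb : ℝ := V₀ * (lam ^ 2 * T) + 2 * lam + 2 with hRb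
  have hRbpos : 0 < Rb := by positivity
  -- flattening of `U` at tolerance `1/(2λ)` on balls of radius `Rb`
  obtain ⟨ρf, hρf⟩ := farField_velocity_osc_of_axisymmetric_add_drift hsol hUM hUx hUt haxi hsw
    hdiv hβm hβC Rb hRbpos (1 / (2 * lam)) (by positivity)
  refine ⟨max ρf (Rb + 4 * lam) + 1, ?_⟩
  intro t₀ ht₀ x₀ hx₀ t ht t' ht' x hx y hy
  have hx₀f : ρf ≤ cylRadius x₀ := by linarith [le_max_left ρf (Rb + 4 * lam)]
  have hx₀b : Rb + 4 * lam + 1 ≤ cylRadius x₀ := by linarith [le_max_right ρf (Rb + 4 * lam)]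
  -- the top time `s'` and the base time `σ₀`
  set s' : ℝ := (max t t' + t₀) / 2 with hs'
  have hmax : max t t' < t₀ := max_lt ht.2 ht'.2
  have hts' : t < s' := by have := le_max_left t t'; rw [hs']; linarith
  have ht's' : t' < s' := by have := le_max_right t t'; rw [hs']; linarith
  have hs'0 : s' < 0 := by rw [hs']; linarith
  have hs't : s' - t < R ^ 2 := by rw [hs']; linarith [ht.1, le_max_left t t']
  have hs't' : s' - t' < R ^ 2 := by rw [hs']; linarith [ht'.1, le_max_right t t']
  set σ₀ : ℝ := s' - lam ^ 2 * T with hσ₀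
  have hσtop : σ₀ + lam ^ 2 * T = s' := by rw [hσ₀]; ring
  have hIneg : ∀ σ ∈ Icc σ₀ (σ₀ + lam ^ 2 * T), σ < 0 := fun σ hσ => by
    rw [hσtop] at hσ; exact hσ.2.trans_lt hs'0
  -- the frame velocity and the frame
  set c₁ : ℝ → EuclideanSpace ℝ (Fin 3) := fun σ => if σ < 0 then U σ x₀ else 0 with hc₁
  have hc₁m : Measurable c₁ := by
    refine Measurable.ite measurableSet_Iio ?_ measurable_const
    exact hUjm.comp (measurable_id.prodMk measurable_const)
  have hc₁N : ∀ σ, ‖c₁ σ‖ ≤ M := by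
    intro σ
    by_cases h : σ < 0
    · simp only [hc₁, h, if_true]; exact hUM σ h x₀
    · simp only [hc₁, h, if_false, norm_zero]; exact hM0
  have hc₁neg : ∀ σ, σ < 0 → c₁ σ = U σ x₀ := fun σ h => by simp only [hc₁, h, if_true]
  set vel : ℝ → EuclideanSpace ℝ (Fin 3) := fun σ => c₁ σ + β σ • eZ with hvel
  have hvelN : ∀ σ, ‖vel σ‖ ≤ V₀ := fun σ => by
    calc ‖vel σ‖ ≤ ‖c₁ σ‖ + ‖β σ • eZ‖ := norm_add_le _ _
      _ ≤ M + C * ‖(eZ : EuclideanSpace ℝ (Fin 3))‖ := by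
          rw [norm_smul, Real.norm_eq_abs]
          exact add_le_add (hc₁N σ) (mul_le_mul_of_nonneg_right (hβC σ) (norm_nonneg _))
      _ ≤ V₀ := by rw [hV₀]; linarith
  have hvelm : AEStronglyMeasurable vel volume := (hc₁m.add (hβm.smul_const _)).aestronglyMeasurable
  have hveli : ∀ a b : ℝ, IntervalIntegrable vel volume a b := intervalIntegrable_of_norm_le hvelm hvelN
  set z : ℝ → EuclideanSpace ℝ (Fin 3) := fun σ => x₀ + ∫ r in s'..σ, vel r with hz
  have hzc : Continuous z :=
    continuous_const.add (intervalIntegral.continuous_primitive (fun a b => hveli a b) s')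
  have hzbase : ∀ σ ∈ Icc σ₀ (σ₀ + lam ^ 2 * T), z σ = z σ₀ + ∫ r in σ₀..σ, (c₁ r + β r • eZ) := by
    intro σ _
    simp only [hz]
    rw [add_assoc, intervalIntegral.integral_add_adjacent_intervals (hveli _ _) (hveli _ _)]
  have hzx₀ : ∀ σ, ‖z σ - x₀‖ ≤ V₀ * |σ - s'| := fun σ => by
    simp only [hz, add_sub_cancel_left]
    rw [intervalIntegral.integral_symm, norm_neg]
    calc ‖∫ r in σ..s', vel r‖ ≤ V₀ * |s' - σ| :=
          intervalIntegral.norm_integral_le_of_norm_le_const fun r _ => hvelN r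
      _ = V₀ * |σ - s'| := by rw [abs_sub_comm]
  have hzx₀' : ∀ σ ∈ Icc σ₀ (σ₀ + lam ^ 2 * T), ‖z σ - x₀‖ ≤ V₀ * (lam ^ 2 * T) := by
    intro σ hσ
    refine (hzx₀ σ).trans (mul_le_mul_of_nonneg_left ?_ hV₀pos.le)
    rw [hσtop] at hσ
    rw [abs_of_nonpos (by linarith [hσ.2])]
    have : σ₀ ≤ σ := hσ.1
    rw [hσ₀] at this; linarith
  -- the ball `B(x₀, Rb)` stays away from the axis: `r ≥ 4λ` there
  have hoff : ∀ w ∈ ball x₀ Rb, 4 * lam ≤ cylRadius w := fun w hw => by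
    have h := cylRadius_sub_le_of_mem_ball_ffs hw
    linarith
  have hoff0 : ∀ w ∈ ball x₀ Rb, cylRadius w ≠ 0 := fun w hw =>
    (lt_of_lt_of_le (by positivity : (0 : ℝ) < 4 * lam) (hoff w hw)).ne'
  -- frame points lie in `B̄(x₀, Rb − 1)`
  have hzin : ∀ σ ∈ Icc σ₀ (σ₀ + lam ^ 2 * T), ∀ yy ∈ ball (0 : EuclideanSpace ℝ (Fin 3)) 2,
      z σ + lam • yy ∈ closedBall x₀ (Rb - 1) := by
    intro σ hσ yy hyy
    rw [mem_closedBall, dist_eq_norm]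
    have hyy' : ‖yy‖ < 2 := by rwa [mem_ball_zero_iff] at hyy
    calc ‖z σ + lam • yy - x₀‖ = ‖(z σ - x₀) + lam • yy‖ := by abel_nf
      _ ≤ ‖z σ - x₀‖ + ‖lam • yy‖ := norm_add_le _ _
      _ ≤ V₀ * (lam ^ 2 * T) + lam * 2 := by
          rw [norm_smul, Real.norm_eq_abs, abs_of_pos hlam]
          exact add_le_add (hzx₀' σ hσ) (mul_le_mul_of_nonneg_left hyy'.le hlam.le)
      _ = Rb - 2 := by rw [hRb]; ring
      _ ≤ Rb - 1 := by linarith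
  have hzinb : ∀ σ ∈ Icc σ₀ (σ₀ + lam ^ 2 * T), ∀ yy ∈ ball (0 : EuclideanSpace ℝ (Fin 3)) 2,
      z σ + lam • yy ∈ ball x₀ Rb := fun σ hσ yy hyy =>
    (closedBall_subset_ball (by linarith)) (hzin σ hσ yy hyy)
  -- smallness of the frame drift
  have hsmall : ∀ σ ∈ Icc σ₀ (σ₀ + lam ^ 2 * T), ∀ yy ∈ ball (0 : EuclideanSpace ℝ (Fin 3)) 2,
      ‖(U σ (z σ + lam • yy) + (2 / cylRadius (z σ + lam • yy)) • eR (z σ + lam • yy)) - c₁ σ‖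
        ≤ 1 / lam := by
    intro σ hσ yy hyy
    have hσn := hIneg σ hσ
    have hp := hzinb σ hσ yy hyy
    rw [hc₁neg σ hσn]
    have h1 : ‖U σ (z σ + lam • yy) - U σ x₀‖ ≤ 1 / (2 * lam) :=
      hρf σ hσn x₀ hx₀f _ hp x₀ (mem_ball_self hRbpos)
    have h2 : ‖(2 / cylRadius (z σ + lam • yy)) • eR (z σ + lam • yy)‖ ≤ 1 / (2 * lam) := by
      have hr := hoff _ hp
      have hrpos : 0 < cylRadius (z σ + lam • yy) :=
        lt_of_lt_of_le (by positivity : (0 : ℝ) < 4 * lam) hr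
      rw [norm_smul, Real.norm_eq_abs, abs_of_pos (by positivity)]
      calc 2 / cylRadius (z σ + lam • yy) * ‖eR (z σ + lam • yy)‖
          ≤ 2 / cylRadius (z σ + lam • yy) * 1 :=
            mul_le_mul_of_nonneg_left (norm_eR_le_one_ffs _) (by positivity)
        _ ≤ 2 / (4 * lam) * 1 := by gcongr
        _ = 1 / (2 * lam) := by field_simp; ring
    calc ‖(U σ (z σ + lam • yy) + (2 / cylRadius (z σ + lam • yy)) • eR (z σ + lam • yy)) - U σ x₀‖
        = ‖(U σ (z σ + lam • yy) - U σ x₀) +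
            (2 / cylRadius (z σ + lam • yy)) • eR (z σ + lam • yy)‖ := by abel_nf
      _ ≤ 1 / (2 * lam) + 1 / (2 * lam) := (norm_add_le _ _).trans (add_le_add h1 h2)
      _ = 1 / lam := by field_simp; ring
  -- regularity data of `Γ = swirl (U t)` and of the drift `b = U + (2/r) e_r`
  obtain ⟨L₀, hL₀⟩ := hlipU 0
  obtain ⟨L₁, hL₁⟩ := hlipU 1
  obtain ⟨L₂, hL₂⟩ := hlipU 2
  have hsubI : Icc σ₀ (σ₀ + lam ^ 2 * T) ×ˢ (univ : Set (EuclideanSpace ℝ (Fin 3))) ⊆ Iio 0 ×ˢ univ :=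
    prod_mono (fun σ hσ => hIneg σ hσ) Subset.rfl
  have hΓ2 : ∀ σ ∈ Icc σ₀ (σ₀ + lam ^ 2 * T), ContDiff ℝ 2 (swirl (U σ)) := fun σ hσ =>
    contDiff_swirl ((hsm σ (hIneg σ hσ)).of_le (by norm_cast))
  have hDΓ := (continuousOn_fderiv_swirl_of_lipschitz hsm hL₀ hL₁).mono hsubI
  have hΔΓ := (continuousOn_laplacian_swirl_of_lipschitz hsm hL₁ hL₂).mono hsubI
  have hUc : ContinuousOn (uncurry U) (Icc σ₀ (σ₀ + lam ^ 2 * T) ×ˢ univ) := by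
    have h := (ContinuousMultilinearMap.apply ℝ (fun _ : Fin 0 => EuclideanSpace ℝ (Fin 3))
      (EuclideanSpace ℝ (Fin 3)) (Fin.elim0 : Fin 0 → EuclideanSpace ℝ (Fin 3))).continuous.comp_continuousOn
      (continuousOn_iteratedFDeriv_of_lipschitz hsm hL₀)
    refine (h.congr fun p _ => ?_).mono hsubI
    simp only [comp_apply, ContinuousMultilinearMap.apply_apply, iteratedFDeriv_zero_apply, uncurry]
  have hbm := measurable_uncurry_swirlDrift hUjm
  have hbc := continuousOn_uncurry_swirlDrift (S := Icc σ₀ (σ₀ + lam ^ 2 * T)) hUc hoff0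
  have heq : ∀ w ∈ ball x₀ Rb, ∀ σ₁ ∈ Icc σ₀ (σ₀ + lam ^ 2 * T), ∀ σ₂ ∈ Icc σ₀ (σ₀ + lam ^ 2 * T),
      σ₁ ≤ σ₂ → swirl (U σ₂) w - swirl (U σ₁) w =
        ∫ r in σ₁..σ₂, ((Δ (swirl (U r))) w -
          fderiv ℝ (swirl (U r)) w (U r w + (2 / cylRadius w) • eR w) -
          β r * fderiv ℝ (swirl (U r)) w eZ) := fun w hw σ₁ _ σ₂ hσ₂ h12 =>
    swirl_sub_eq_integral_drift_form hswirlEq (hoff0 w hw) h12 (hIneg σ₂ hσ₂)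
  -- the swirl in the rescaled Galilean frame is in the local drift–heat class
  have hclass := isDriftHeatSolutionOn_galilean_rescale (Γ := fun σ => swirl (U σ))
    (b := fun σ w => U σ w + (2 / cylRadius w) • eR w) (c₁ := c₁) (β := β) (e := eZ) (z := z)
    (x₀ := x₀) (R := Rb) (σ₀ := σ₀) (lam := lam) (T := T) (ϱ₀ := 2) (A := 1) (N := M) (Cβ := C)
    hlam hΓ2 hDΓ hΔΓ hbm hbc hc₁m hc₁N hβm hβC heq hzc hzbase hzin hsmall
  -- bounds `−C₁ ≤ w ≤ C₁`
  have hbd : ∀ τ ∈ Ioc (0 : ℝ) T, ∀ ζ ∈ ball (0 : EuclideanSpace ℝ (Fin 3)) 2,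
      -C₁ ≤ swirl (U (lam ^ 2 * τ + σ₀)) (z (lam ^ 2 * τ + σ₀) + lam • ζ) ∧
        swirl (U (lam ^ 2 * τ + σ₀)) (z (lam ^ 2 * τ + σ₀) + lam • ζ) ≤ C₁ := by
    intro τ hτ ζ _
    have hl2 : 0 < lam ^ 2 := by positivity
    have hσI : lam ^ 2 * τ + σ₀ ∈ Icc σ₀ (σ₀ + lam ^ 2 * T) := by
      have h1 := mul_pos hl2 hτ.1
      have h2 := mul_le_mul_of_nonneg_left hτ.2 hl2.le
      exact ⟨by linarith, by linarith⟩
    exact abs_le.1 (hsw _ (hIneg _ hσI) _)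
  -- oscillation decay on `Q((0, T), 4^{-j})`
  have hosc : ∀ {τa : ℝ} {ζa : EuclideanSpace ℝ (Fin 3)} {τb : ℝ} {ζb : EuclideanSpace ℝ (Fin 3)},
      τa ∈ Ioo (T - (1 / 4 ^ j) ^ 2) T → ζa ∈ ball (0 : EuclideanSpace ℝ (Fin 3)) (1 / 4 ^ j) →
      τb ∈ Ioo (T - (1 / 4 ^ j) ^ 2) T → ζb ∈ ball (0 : EuclideanSpace ℝ (Fin 3)) (1 / 4 ^ j) →
      swirl (U (lam ^ 2 * τa + σ₀)) (z (lam ^ 2 * τa + σ₀) + lam • ζa) -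
        swirl (U (lam ^ 2 * τb + σ₀)) (z (lam ^ 2 * τb + σ₀) + lam • ζb) ≤ ε := by
    intro τa ζa τb ζb hτa hζa hτb hζb
    have h := hH.osc_iterate hCH1 isOpen_ball hclass hbd (x := 0) (s' := T) (ρ := 1) one_pos le_rfl
      (closedBall_subset_ball (by norm_num)) (by rw [hT]; norm_num) le_rfl j hτa hζa hτb hζb
    exact h.trans hθj
  -- frame coordinates of `(t, x)` and `(t', y)`
  have hframe : ∀ {tt : ℝ} {xx : EuclideanSpace ℝ (Fin 3)}, tt < s' → s' - tt < R ^ 2 →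
      xx ∈ ball x₀ R →
      (T + (tt - s') / lam ^ 2) ∈ Ioo (T - (1 / 4 ^ j) ^ 2) T ∧
      lam⁻¹ • (xx - z tt) ∈ ball (0 : EuclideanSpace ℝ (Fin 3)) (1 / 4 ^ j) ∧
      lam ^ 2 * (T + (tt - s') / lam ^ 2) + σ₀ = tt ∧
      z (lam ^ 2 * (T + (tt - s') / lam ^ 2) + σ₀) + lam • (lam⁻¹ • (xx - z tt)) = xx := by
    intro tt xx htt hst hxx
    have hl2 : 0 < lam ^ 2 := by positivity
    have htime : lam ^ 2 * (T + (tt - s') / lam ^ 2) + σ₀ = tt := by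
      rw [hσ₀]; field_simp; ring
    refine ⟨⟨?_, ?_⟩, ?_, htime, ?_⟩
    · -- `T − 16^{-j} < τ`
      have h1 : (s' - tt) / lam ^ 2 < (1 / 4 ^ j) ^ 2 := by
        rw [div_lt_iff₀ hl2, hlamdef]
        have hRR : R ^ 2 < Rin ^ 2 := pow_lt_pow_left₀ hRinR hR.le two_ne_zero
        calc s' - tt < R ^ 2 := hst
          _ < Rin ^ 2 := hRR
          _ = (1 / 4 ^ j) ^ 2 * (4 ^ j * Rin) ^ 2 := by field_simp
      have h2 : (tt - s') / lam ^ 2 = -((s' - tt) / lam ^ 2) := by ring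
      rw [h2]
      linarith only [h1]
    · have h3 : (tt - s') / lam ^ 2 < 0 := div_neg_of_neg_of_pos (by linarith only [htt]) hl2
      linarith only [h3]
    · rw [mem_ball_zero_iff, norm_smul, norm_inv, Real.norm_eq_abs, abs_of_pos hlam]
      have hxz : ‖xx - z tt‖ < Rin := by
        calc ‖xx - z tt‖ ≤ ‖xx - x₀‖ + ‖x₀ - z tt‖ := norm_sub_le_norm_sub_add_norm_sub _ _ _
          _ ≤ R + V₀ * R ^ 2 := by
              refine add_le_add ?_ ?_
              · exact (mem_ball_iff_norm.1 hxx).le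
              · rw [norm_sub_rev]
                refine (hzx₀ tt).trans (mul_le_mul_of_nonneg_left ?_ hV₀pos.le)
                rw [abs_of_nonpos (by linarith only [htt])]
                linarith only [hst]
          _ < Rin := by rw [hRin]; linarith only []
      rw [inv_mul_lt_iff₀ hlam, hlamdef]
      calc ‖xx - z tt‖ < Rin := hxz
        _ = 4 ^ j * Rin * (1 / 4 ^ j) := by field_simp
    · rw [htime, smul_smul, mul_inv_cancel₀ hlam.ne', one_smul, add_sub_cancel]
  obtain ⟨hτa, hζa, hta, hxa⟩ := hframe hts' hs't hx
  obtain ⟨hτb, hζb, htb, hyb⟩ := hframe ht's' hs't' hy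
  have h1 := hosc hτa hζa hτb hζb
  have h2 := hosc hτb hζb hτa hζa
  rw [hta] at hxa
  rw [htb] at hyb
  rw [hta, hxa, htb, hyb] at h1 h2
  exact abs_le.2 ⟨by linarith only [h2], h1⟩

end FarFieldSwirl

end Literature.Analysis.FluidPDE

end
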